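import Summits.Ventures.HSemireg.WedgeHankelPlaneProjections
import Summits.Ventures.HSemireg.WedgeKunnethKernel

/-!
# Venture HSemireg — THE CONFLUENT KERNEL LAW at the node `0`: a `K[Θ]`-class `v = Σ_{p ≤ P} q_p Θ^p/p!` with `q_P ≠ 0` has, in every degree
# `k ≤ n − P`, the kernel `SI_k ⊕ (forms with more than P x-letters)` — it depends only on the ORDER `P + 1` of the class at the node

HONEST FRAMING. Part of the Lean index of the computation cell `pub-hsemireg` (seat p10 gen 15, Sunday typer «UNIFORM-IN-n»).
Finite-dimensional EXTERIOR ALGEBRA over a field ONLY: no variety, no cohomology theory, no sheaf, no Ext group, no semiregularity map;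
nothing here says that HC / HC_CM / HC_AV holds; no Literature fact is declared or used.  Custodian versions as in `WedgeHankelSiegelIdeal`
(1/3): FORMULA-N PART A §2.6 THEOREM H / §4.1″ (per-block laws), PART B §N.8 (th-7's recursion); STRUCTURE.md v1.0-SIGNED 9b196a05977dd067
§1.1 (C4: the NAME of the kernel).  The dictionary (`v = Σ_j q_j Θ^j/j!` ↦ `w_n(q)`, `Θ^p/p! ↦ E_p = w_n(δ_p)`; `plane(a,b) ↔ H^b(⋀^a T)`;
`⌟v` ↦ `θ ↦ θ ∧ w_n(q)`) is QUOTED, never asserted.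

WHAT IS IN THE TREE / KEYED.  The lineage names the kernel `Kr(univ, w_n(q), k)` for the classes of Hankel rank `1` (gen 13: frame ideals),
for sums of DISTINCT exponentials (gen 14: intersections of frame ideals) and at the generic rank (gen 11: the Siegel ideal `SI_k`); gen 11's
`…PlaneRank` (row 691) gives the kernel of ANY class on ONE Dolbeault block (`ker_wedgeP_of_window_ne`: the isotropic part as soon as the window
`(q_a, …, q_{a+n−k})` is non-zero; `plane_le_ker_of_window`: the whole block when it vanishes); gen 15's `WedgeHankelPlaneProjections`
the projections; gen 11's `…BlockSum` (698) proves THE BLOCK-SUM KERNEL THEOREM `ker_wedge_eq_sup_blockKer` (kernel = sum of the block kernels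
whenever the non-zero rows of `H_k(q)` are independent — true for the classes below, whose `H_k(q)` is anti-triangular; that route needs the rank
computation, the route here does not and lands in the NAMED form `SI_k ⊔ xRich`).  Gen 14 left OPEN the CONFLUENT faces (READ-NOTE-p10-g14 §F (vi), HANDOFF «Gen 14 STATE» 4 (a): «conjecture:
`Kr(univ, w_m(Aδ_0 + Bδ_1), k) = Kr(univ, w_m(δ_1), k) = {≥ 2 x-letters} ⊕ (SI_k ∩ plane(1,k−1))`»).  THIS FILE proves it, for every order:
* §18 `xRich n k P := Σ_{P < a ≤ k} plane(a, k−a)` — the degree-`k` forms with MORE THAN `P` `x`-letters (dictionary: `⊕_{a > P} H^{k−a}(⋀^a T)`);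
  `xRich_le_ker`: they kill every class supported on `[0, P]` (zero windows); `siegelIdeal_sup_xRich_le_ker`.
* §19 **THE INDUCTION `prj_mem_siegelIdeal_of_mul_w_eq_zero`**: if `q_j = 0` for `j > P`, `q_P ≠ 0`, `k + P ≤ n` and `θ ∧ w_n(q) = 0` (`θ ∈ ⋀^k`), then
  EVERY component `prj a (k−a) θ` with `a ≤ P` lies in `SI_k` — project `θ ∧ w_n(q) = Σ_{e,p} q_p · θ_e ∧ E_p` onto the plane
  `(a + n − P, k − a + P)`: only the pairs with `e + P = a + p` survive, those with `e < a` vanish by induction (`SI_k` kills every class), leaving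
  `q_P · θ_a ∧ E_P = 0`, and 691's block law (window entry `δ_P(a + (P − a)) = 1`, `P − a ≤ n − k`) puts `θ_a` in the isotropic part.
* §20 **THE CONFLUENT KERNEL LAW `ker_wedge_w_eq_of_order` / `Kr_w_eq_of_order`: `Kr(univ, w_n(q), k) = SI_k ⊔ xRich(k, P)` for every such `q`
  and every `k ≤ n − P`** — the kernel of a class with a `(P+1)`-fold node at `0` DEPENDS ONLY ON `P`: **`Kr_w_eq_Kr_w_of_order`** (two classes of
  the same order `P` at `0` have the same kernels in all degrees `k ≤ n − P`), **`Kr_w_eq_Kr_spike`** (`= Kr` of the power `E_P = Θ^P/P!`),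
  **`Kr_w_eq_siegelIdeal_of_le`** (`P ≥ k` ⇒ the generic kernel `SI_k`), and gen 14's conjecture (a) verbatim: **`Kr_w_tangent`**:
  `Kr(univ, w_n(A δ_0 + B δ_1), k) = Kr(univ, w_n(δ_1), k) = SI_k ⊔ xRich(k, 1)` for `B ≠ 0`, `k + 1 ≤ n`; and since every Siegel generator
  has an `x`-letter (`siegelIdeal_le_xRich_zero`), **`Kr_w_pure_zero`: the pure class `A·δ_0` has kernel EXACTLY `xRich(k, 0)` = the forms with an
  `x`-letter** — gen 13's frame ideal `F_0(k)`, recovered from the confluent law.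
NOT typed here: the orders at a node `λ ≠ 0` / at `∞` (translate by the frame change `x_a ↦ x_a + λ y_a`, resp. the mirror `x ↔ y`; the lineage's
`uvec`), several confluent nodes (the divisor `Σ_i (P_i + 1)[λ_i]`), and the degrees `k > n − P` (there the low blocks see zero windows of `E_P` and
the lower powers matter); anything Ext-side.  Class side only.
-/

open Module

namespace Summit.Ventures.HSemireg.Wedge.HankelSiegelIdeal

open Summit.Ventures.HSemireg.Wedge Summit.Ventures.HSemireg.Wedge.Hankel
  Summit.Ventures.HSemireg.Wedge.HankelSiegel Summit.Ventures.HSemireg.Wedge.KunnethKernel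

variable (K : Type*) [Field K] {n : ℕ}

/-! ## §18. The forms with more than `P` `x`-letters -/

/-- **`xRich n k P := Σ_{P < a ≤ k} plane(a, k − a)`**: the degree-`k` forms all of whose monomials have MORE THAN `P` `x`-letters
(dictionary: `⊕_{a > P} H^{k−a}(⋀^a T)`). -/
noncomputable def xRich (n k P : ℕ) : Submodule K (HT K (In n)) := ⨆ a ∈ Finset.Ioc P k, plane K n a (k - a)

/-- `xRich ⊆ ⋀^k`. -/
theorem xRich_le_exteriorPower (k P : ℕ) : xRich K n k P ≤ ⋀[K]^k (In n → K) := by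
  refine iSup₂_le fun a ha => ?_
  rw [Finset.mem_Ioc] at ha
  have := plane_le_exteriorPower K (n := n) a (k - a)
  rwa [show a + (k - a) = k by omega] at this

/-- a plane with more than `P` `x`-letters lies in `xRich`. -/
lemma plane_le_xRich {k P a : ℕ} (ha : P < a) (hak : a ≤ k) : plane K n a (k - a) ≤ xRich K n k P :=
  le_iSup₂_of_le (f := fun a _ => plane K n a (k - a)) a (Finset.mem_Ioc.mpr ⟨ha, hak⟩) le_rfl

/-- forms with more than `P` `x`-letters kill every class supported on `[0, P]` (`k ≤ n`), submodule form. -/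
theorem xRich_le_ker_mulRight {k P : ℕ} (hk : k ≤ n) {q : ℕ → K} (hq : ∀ j, P < j → q j = 0) :
    xRich K n k P ≤ LinearMap.ker (LinearMap.mulRight K (w K n n q)) := by
  refine iSup₂_le fun a ha => fun x hx => ?_
  rw [Finset.mem_Ioc] at ha
  rw [LinearMap.mem_ker, LinearMap.mulRight_apply]
  exact plane_mul_w_eq_zero_of_window K (by omega) (fun s _ => hq _ (by omega)) hx

/-- **FORMS WITH MORE THAN `P` `x`-LETTERS KILL EVERY CLASS SUPPORTED ON `[0, P]`** (`k ≤ n`): all their windows vanish. -/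
theorem mul_w_eq_zero_of_mem_xRich {k P : ℕ} (hk : k ≤ n) {q : ℕ → K} (hq : ∀ j, P < j → q j = 0) {θ : HT K (In n)}
    (hθ : θ ∈ xRich K n k P) : θ * w K n n q = 0 := by
  have h := xRich_le_ker_mulRight K hk hq hθ
  rwa [LinearMap.mem_ker, LinearMap.mulRight_apply] at h

/-- **`SI_k ⊔ xRich(k, P)` kills every class supported on `[0, P]`** (`k ≤ n`). -/
theorem mul_w_eq_zero_of_mem_sup {k P : ℕ} (hk : k ≤ n) {q : ℕ → K} (hq : ∀ j, P < j → q j = 0) {θ : HT K (In n)}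
    (hθ : θ ∈ siegelIdeal K n k ⊔ xRich K n k P) : θ * w K n n q = 0 := by
  obtain ⟨y, hy, z, hz, rfl⟩ := Submodule.mem_sup.mp hθ
  rw [add_mul, mul_w_eq_zero_of_mem_siegelIdeal K hy q, mul_w_eq_zero_of_mem_xRich K hk hq hz, add_zero]

/-! ## §19. The induction: the low components of a form killing the class are isotropic -/

/-- expansion of `θ ∧ w_n(q)` over the components of `θ ∈ ⋀^k` and the powers `E_p`, `p ≤ P`, for `q` supported on `[0, P]`, `P ≤ n`. -/
lemma mul_w_eq_sum_sum {k P : ℕ} (hP : P ≤ n) {q : ℕ → K} (hq : ∀ j, P < j → q j = 0) {θ : HT K (In n)}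
    (hθ : θ ∈ ⋀[K]^k (In n → K)) :
    θ * w K n n q = ∑ e ∈ Finset.range (k + 1), ∑ p ∈ Finset.range (P + 1),
      q p • (prj K n e (k - e) θ * w K n n (fun j => if j = p then (1 : K) else 0)) := by
  have hw : w K n n q = ∑ p ∈ Finset.range (P + 1), q p • w K n n (fun j => if j = p then (1 : K) else 0) := by
    rw [w_eq_sum_spikes K q]
    symm
    apply Finset.sum_subset (Finset.range_subset_range.mpr (by omega))
    intro p hp hp'
    rw [Finset.mem_range] at hp hp'
    rw [hq p (by omega), zero_smul]
  conv_lhs => rw [← sum_prj K hθ, hw, Finset.sum_mul]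
  refine Finset.sum_congr rfl fun e _ => ?_
  rw [Finset.mul_sum]
  refine Finset.sum_congr rfl fun p _ => ?_
  rw [mul_smul_comm]

/-- **THE INDUCTION**: `q` supported on `[0, P]` with `q_P ≠ 0`, `k + P ≤ n`, `θ ∈ ⋀^k` with `θ ∧ w_n(q) = 0` ⇒ every component
`prj a (k−a) θ` with `a ≤ P` lies in the Siegel ideal `SI_k`. -/
theorem prj_mem_siegelIdeal_of_mul_w_eq_zero {k P : ℕ} (hkP : k + P ≤ n) {q : ℕ → K} (hq : ∀ j, P < j → q j = 0) (hqP : q P ≠ 0)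
    {θ : HT K (In n)} (hθ : θ ∈ ⋀[K]^k (In n → K)) (h0 : θ * w K n n q = 0) :
    ∀ a, a ≤ P → prj K n a (k - a) θ ∈ siegelIdeal K n k := by
  intro a
  induction a using Nat.strong_induction_on with
  | _ a IH =>
  intro haP
  by_cases hak : a ≤ k
  swap
  · rw [prj_eq_zero_of_ne K (by omega) hθ]; exact Submodule.zero_mem _
  -- project the expansion of θ ∧ w_n(q) = 0 onto the plane (a + (n − P), (k − a) + P)
  have hexp := mul_w_eq_sum_sum K (by omega) hq hθ (k := k)
  rw [h0] at hexp
  have hp := congrArg (prj K n (a + (n - P)) (k - a + P)) hexp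
  rw [map_zero, map_sum, Finset.sum_eq_single a] at hp
  · -- the inner sum at e = a: only p = P survives
    rw [map_sum, Finset.sum_eq_single P] at hp
    · rw [map_smul, prj_of_mem_plane K (by
        have := mul_w_spike_mem_plane K (a := a) (b := k - a) (p := P) (by omega) (prj_mem_plane K a (k - a) θ)
        exact this)] at hp
      have hE : prj K n a (k - a) θ * w K n n (fun j => if j = P then (1 : K) else 0) = 0 :=
        (smul_eq_zero.mp hp.symm).resolve_left hqP
      -- 691's block law on the plane (a, k − a) for the spike δ_P: window entry at s = P − a
      have hker : (⟨prj K n a (k - a) θ, prj_mem_plane K a (k - a) θ⟩ : plane K n a (k - a)) ∈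
          LinearMap.ker (wedgeP K n a (k - a) (fun j => if j = P then (1 : K) else 0)) := by
        rw [LinearMap.mem_ker, wedgeP, LinearMap.comp_apply, Submodule.subtype_apply, LinearMap.mulRight_apply]; exact hE
      rw [ker_wedgeP_of_window_ne K (s := P - a) (by omega) (by rw [if_pos (by omega)]; exact one_ne_zero),
        Submodule.mem_comap, Submodule.subtype_apply, show a + (k - a) = k by omega] at hker
      exact hker
    · intro p hp' hpP
      rw [Finset.mem_range] at hp'
      rw [map_smul, prj_of_mem_plane_ne K (by omega) (mul_w_spike_mem_plane K (by omega) (prj_mem_plane K a (k - a) θ)),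
        smul_zero]
    · intro h; exact absurd (Finset.mem_range.mpr (by omega)) h
  · -- the inner sums at e ≠ a vanish after projection
    intro e he hea
    rw [Finset.mem_range] at he
    rw [map_sum]
    refine Finset.sum_eq_zero fun p hp' => ?_
    rw [Finset.mem_range] at hp'
    rw [map_smul]
    by_cases hep : e + P = a + p
    · -- then e < a, and the component θ_e is already isotropic
      have hlt : e < a := by omega
      rw [mul_w_eq_zero_of_mem_siegelIdeal K (IH e hlt (by omega)), map_zero, smul_zero]
    · rw [prj_of_mem_plane_ne K (by omega) (mul_w_spike_mem_plane K (by omega) (prj_mem_plane K e (k - e) θ)), smul_zero]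
  · intro h; exact absurd (Finset.mem_range.mpr (by omega)) h

/-- hence such a `θ` lies in `SI_k ⊔ xRich(k, P)`: its components with `a ≤ P` are isotropic, the others have more than `P` `x`-letters. -/
theorem mem_sup_of_mul_w_eq_zero {k P : ℕ} (hkP : k + P ≤ n) {q : ℕ → K} (hq : ∀ j, P < j → q j = 0) (hqP : q P ≠ 0)
    {θ : HT K (In n)} (hθ : θ ∈ ⋀[K]^k (In n → K)) (h0 : θ * w K n n q = 0) :
    θ ∈ siegelIdeal K n k ⊔ xRich K n k P := by
  rw [← sum_prj K hθ]
  refine Submodule.sum_mem _ fun a ha => ?_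
  rw [Finset.mem_range] at ha
  by_cases haP : a ≤ P
  · exact Submodule.mem_sup_left (prj_mem_siegelIdeal_of_mul_w_eq_zero K hkP hq hqP hθ h0 a haP)
  · exact Submodule.mem_sup_right (plane_le_xRich K (by omega) (by omega) (prj_mem_plane K a (k - a) θ))

/-! ## §20. The confluent kernel law -/

/-- **THE CONFLUENT KERNEL LAW (wedge form)**: for `q` supported on `[0, P]` with `q_P ≠ 0` and `k + P ≤ n`,
`ker(θ ↦ θ ∧ w_n(q) ∣ ⋀^k) = SI_k ⊔ xRich(k, P)`. -/
theorem ker_wedge_w_eq_of_order {k P : ℕ} (hkP : k + P ≤ n) {q : ℕ → K} (hq : ∀ j, P < j → q j = 0) (hqP : q P ≠ 0) :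
    LinearMap.ker (Hankel.wedge K n k (w K n n q)) = (siegelIdeal K n k ⊔ xRich K n k P).comap (⋀[K]^k (In n → K)).subtype := by
  ext θ
  rw [LinearMap.mem_ker, Submodule.mem_comap, Submodule.subtype_apply, Hankel.wedge, LinearMap.comp_apply,
    Submodule.subtype_apply, LinearMap.mulRight_apply]
  exact ⟨fun h => mem_sup_of_mul_w_eq_zero K hkP hq hqP θ.2 h, fun h => mul_w_eq_zero_of_mem_sup K (by omega) hq h⟩

/-- **THE CONFLUENT KERNEL LAW: `Kr(univ, w_n(q), k) = SI_k ⊔ xRich(k, P)`** for `q` supported on `[0, P]`, `q_P ≠ 0`, `k + P ≤ n` — the kernel of a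
`K[Θ]`-class with a `(P+1)`-fold node at `0` is the Siegel ideal plus the forms with more than `P` `x`-letters. -/
theorem Kr_w_eq_of_order {k P : ℕ} (hkP : k + P ≤ n) {q : ℕ → K} (hq : ∀ j, P < j → q j = 0) (hqP : q P ≠ 0) :
    Kr K Finset.univ (w K n n q) k = siegelIdeal K n k ⊔ xRich K n k P := by
  ext θ
  rw [mem_Kr, KunnethKernel.Hom_univ_eq_exteriorPower]
  constructor
  · rintro ⟨hθ, h0⟩; exact mem_sup_of_mul_w_eq_zero K hkP hq hqP hθ h0
  · intro h
    exact ⟨sup_le (siegelIdeal_le_exteriorPower K k) (xRich_le_exteriorPower K k P) h, mul_w_eq_zero_of_mem_sup K (by omega) hq h⟩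

/-- **THE KERNEL DEPENDS ONLY ON THE ORDER AT THE NODE**: two classes supported on `[0, P]` with non-zero `P`-th coefficient have the SAME
kernel in every degree `k ≤ n − P`. -/
theorem Kr_w_eq_Kr_w_of_order {k P : ℕ} (hkP : k + P ≤ n) {q q' : ℕ → K} (hq : ∀ j, P < j → q j = 0) (hqP : q P ≠ 0)
    (hq' : ∀ j, P < j → q' j = 0) (hqP' : q' P ≠ 0) :
    Kr K Finset.univ (w K n n q) k = Kr K Finset.univ (w K n n q') k := by
  rw [Kr_w_eq_of_order K hkP hq hqP, Kr_w_eq_of_order K hkP hq' hqP']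

/-- **… IN PARTICULAR IT IS THE KERNEL OF THE POWER `E_P = w_n(δ_P)` (`Θ^P/P!`).** -/
theorem Kr_w_eq_Kr_spike {k P : ℕ} (hkP : k + P ≤ n) {q : ℕ → K} (hq : ∀ j, P < j → q j = 0) (hqP : q P ≠ 0) :
    Kr K Finset.univ (w K n n q) k = Kr K Finset.univ (w K n n (fun j => if j = P then (1 : K) else 0)) k :=
  Kr_w_eq_Kr_w_of_order K hkP hq hqP (fun j hj => if_neg (by omega)) (by rw [if_pos rfl]; exact one_ne_zero)

/-- **THE KERNEL OF A POWER: `Kr(univ, E_P, k) = SI_k ⊔ xRich(k, P)`** for `k + P ≤ n` (cf. (10)'s `ker_wedge_spike_eq_sup_blockKer`, the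
block-kernel form for every `k ≤ n`). -/
theorem Kr_w_spike {k P : ℕ} (hkP : k + P ≤ n) :
    Kr K Finset.univ (w K n n (fun j => if j = P then (1 : K) else 0)) k = siegelIdeal K n k ⊔ xRich K n k P :=
  Kr_w_eq_of_order K hkP (fun j hj => if_neg (by omega)) (by rw [if_pos rfl]; exact one_ne_zero)

/-- **ORDER AT LEAST THE DEGREE ⇒ THE GENERIC KERNEL**: for `P ≥ k` (and `k + P ≤ n`) the kernel is exactly `SI_k` (no block has more than `k ≥ P`
… more than `P` `x`-letters). -/
theorem Kr_w_eq_siegelIdeal_of_le {k P : ℕ} (hkP : k + P ≤ n) (hPk : k ≤ P) {q : ℕ → K} (hq : ∀ j, P < j → q j = 0) (hqP : q P ≠ 0) :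
    Kr K Finset.univ (w K n n q) k = siegelIdeal K n k := by
  rw [Kr_w_eq_of_order K hkP hq hqP, xRich, Finset.Ioc_eq_empty (by omega)]
  simp

/-- **GEN 14's CONJECTURE (a), THE TANGENT CLASS: `Kr(univ, w_n(A δ_0 + B δ_1), k) = Kr(univ, w_n(δ_1), k) = SI_k ⊔ xRich(k, 1)`** for `B ≠ 0` and
`k + 1 ≤ n` — the kernel of `A + BΘ` is that of `Θ`: the isotropic parts of `H^k(𝒪) ⊕ H^{k−1}(T)` plus everything with at least two `x`-letters. -/
theorem Kr_w_tangent {k : ℕ} (hk : k + 1 ≤ n) (A : K) {B : K} (hB : B ≠ 0) :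
    Kr K Finset.univ (w K n n (fun j => if j = 0 then A else if j = 1 then B else 0)) k = siegelIdeal K n k ⊔ xRich K n k 1 ∧
    Kr K Finset.univ (w K n n (fun j => if j = 0 then A else if j = 1 then B else 0)) k =
      Kr K Finset.univ (w K n n (fun j => if j = 1 then (1 : K) else 0)) k := by
  have hq : ∀ j, 1 < j → (fun j => if j = 0 then A else if j = 1 then B else 0) j = 0 := fun j hj => by
    simp only; rw [if_neg (by omega), if_neg (by omega)]
  have hq1 : (fun j => if j = 0 then A else if j = 1 then B else 0) 1 ≠ 0 := by simpa using hB
  exact ⟨Kr_w_eq_of_order K hk hq hq1, Kr_w_eq_Kr_spike K hk hq hq1⟩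

/-- **THE SIEGEL IDEAL HAS AN `x`-LETTER EVERYWHERE: `SI_k ≤ xRich(k, 0)`** (each generator `E_t ∧ s_{ab}` lies in the block
`(|Pof t| + 1, |Qof t| + 1)`, (9)'s `igen_mem_plane`). -/
theorem siegelIdeal_le_xRich_zero (k : ℕ) : siegelIdeal K n k ≤ xRich K n k 0 := by
  rw [siegelIdeal, Submodule.span_le]
  rintro _ ⟨p, rfl⟩
  have h := igen_mem_plane K p
  have hk : (Pof p.1.1).card + 1 + ((Qof p.1.1).card + 1) = k := by
    have := card_Pof_add_card_Qof p.1.1; have := p.1.2; omega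
  rw [show (Qof p.1.1).card + 1 = k - ((Pof p.1.1).card + 1) by omega] at h
  exact plane_le_xRich K (by omega) (by omega) h

/-- **THE PURE CLASS AT THE NODE `0`: `Kr(univ, w_n(A·δ_0), k) = xRich(k, 0)`** (`A ≠ 0`, `k ≤ n`) — exactly the forms with at least one `x`-letter,
i.e. the degree-`k` part of the ideal of the frame `{x_a}`: gen 13's frame ideal `F_0(k)` (there from the rank, here from the confluent law). -/
theorem Kr_w_pure_zero {k : ℕ} (hk : k ≤ n) {A : K} (hA : A ≠ 0) :
    Kr K Finset.univ (w K n n (fun j => if j = 0 then A else 0)) k = xRich K n k 0 := by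
  rw [Kr_w_eq_of_order K (P := 0) (by omega) (fun j hj => if_neg (by omega)) (by rwa [if_pos rfl]), sup_eq_right]
  exact siegelIdeal_le_xRich_zero K k

end Summit.Ventures.HSemireg.Wedge.HankelSiegelIdeal
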